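import Mathlib.Topology.ContinuousOn
import Mathlib.Topology.Separation.Regular
import Mathlib.Algebra.Order.Floor.Semiring
import Mathlib.Logic.Function.Iterate
import Literature.Dynamics.TopologicalDynamics.UniformRecurrence
import Literature.Dynamics.TopologicalDynamics.MinimalOrbitClosure
import HarnessLib

/-!
# Crux `RecurrentLiouville` (stmt-NavierStokesRegularity-1589), line `Sketch` (v9) — stub H2:
  backward-step uniform recurrence of an `ℝ`-flow on a compact Hausdorff space is two-sided

`stub_prTwoSidedRecurrence`: let `ℝ` act on a compact Hausdorff space `X` by continuous maps
`ϕ t` with the action law `ϕ (s + t) = ϕ s ∘ ϕ t` and `ϕ 0 = id` (so every `ϕ t` is a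
homeomorphism with inverse `ϕ (-t)`).  If `y` is uniformly recurrent (= almost periodic in the
sense of Gottschalk–Hedlund) for the BACKWARD unit-step action `n ↦ ϕ (−n)`, `n : ℕ`, then `y` is
uniformly recurrent for the whole flow: for every neighbourhood `U` of `y` the set of real return
times `{t | ϕ t y ∈ U}` is relatively dense (syndetic) in `ℝ`.

Proof (Gottschalk–Hedlund, "one-sided almost periodicity is two-sided").  Put `T = ϕ (−1)` and
`S = ϕ 1 = T⁻¹`; then `ϕ (−n) = T^[n]` and `ϕ n = S^[n]`.
* The discrete core `prTS_isUniformlyRecurrentPt_iterate_symm`: if `y` is uniformly recurrent for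
  `n ↦ T^[n]` then it is uniformly recurrent for `n ↦ S^[n]`.  Let `M` be the `T`-orbit closure of
  `y`; by Furstenberg 1.17 (`closure_orbit_eq_of_isUniformlyRecurrentPt`, for the `ℕ`-action, which
  is jointly continuous because `ℕ` is discrete; compact Hausdorff spaces are regular) `M` is
  `T`-minimal.  `T '' M` is closed, `T`-invariant and meets `M`, so `M ⊆ T '' M`, whence `S M ⊆ M`.
  For `z ∈ M` the `S`-ω-limit set `A = ⋂ N, closure {S^[n] z | n ≥ N}` is nonempty (Cantor), closed,
  contained in `M`, and `T`-invariant (`T (S^[n+1] z) = S^[n] z`), hence `M ⊆ A` by minimality; so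
  `y ∈ A ⊆ closure {S^[n] z}`.  Birkhoff's finite-subcover half (Furstenberg 1.15,
  `isUniformlyRecurrentPt_of_mem_closure_orbit`) on the compact `S`-invariant set `M` makes `y`
  uniformly recurrent for `S`.
* Assembly: integer return times with gaps `≤ N₁` backwards and `≤ N₂` forwards give a real return
  time in every window `[a, a + N₁ + N₂ + 1]` (`isSyndetic_iff_exists_window`).

## References

* W. H. Gottschalk, G. A. Hedlund, *Topological Dynamics*, AMS Colloq. Publ. 36 (1955), Ch. 4.
* H. Furstenberg, *Recurrence in Ergodic Theory and Combinatorial Number Theory*, Princeton UP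
  (1981), Ch. 1 §4, Thms 1.15–1.17. [Furstenberg1981]
-/

-- the sub-problem namespace repeats the summit name (D-0017 layout `Summit.<S>.<P>.Theorems`)
set_option linter.dupNamespace false

namespace Summit.NavierStokesRegularity.NavierStokesRegularity.Theorems

open Set Filter Function Topology
open Literature.Dynamics.TopologicalDynamics

/-! ## Bounded gaps for syndetic sets of naturals -/

/-- A syndetic set of natural numbers has BOUNDED GAPS: there is `N` such that every `g` can be
moved into the set by adding some `k ≤ N` (a compact set of corrections in `ℕ` is finite, hence
bounded). [folklore] -/
theorem prTS_exists_bound_of_isSyndetic {R : Set ℕ} (h : IsSyndetic R) :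
    ∃ N : ℕ, ∀ g : ℕ, ∃ k ≤ N, g + k ∈ R := by
  obtain ⟨K, hK, hR⟩ := h
  obtain ⟨N, hN⟩ := hK.finite_of_discrete.bddAbove
  exact ⟨N, fun g => let ⟨k, hk, hgk⟩ := hR g; ⟨k, hN hk, hgk⟩⟩

/-! ## The discrete core: `T`-uniform recurrence gives `T⁻¹`-uniform recurrence -/

section Discrete

variable {X : Type*} [TopologicalSpace X]

/-- An `ℕ`-action by continuous maps is jointly continuous (`ℕ` is discrete). [folklore] -/
theorem prTS_continuous_uncurry_nat {ψ : ℕ → X → X} (h : ∀ n, Continuous (ψ n)) :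
    Continuous fun p : ℕ × X => ψ p.1 p.2 :=
  continuous_prod_of_discrete_left.2 h

/-- **One-sided uniform recurrence of a homeomorphism is two-sided** (Gottschalk–Hedlund; the
discrete core of Furstenberg 1981, Thm. 1.17 ⇒ two-sidedness): on a compact Hausdorff space, if
`T` and `S` are mutually inverse continuous maps and `y` is uniformly recurrent for the iterates of
`T`, then `y` is uniformly recurrent for the iterates of `S = T⁻¹`.  Proof: the `T`-orbit closure
`M` of `y` is `T`-minimal, hence `S`-invariant; every `S`-ω-limit set of a point of `M` is a
nonempty closed `T`-invariant subset of `M`, hence all of `M`, so `y` lies in the `S`-orbit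
closure of every point of `M`, and Birkhoff's finite-subcover argument applies.
[cite: Furstenberg1981, Ch. 1 §4, Thm. 1.17] -/
theorem prTS_isUniformlyRecurrentPt_iterate_symm [CompactSpace X] [T2Space X] {T S : X → X}
    (hT : Continuous T) (hS : Continuous S) (hST : ∀ x, S (T x) = x) (hTS : ∀ x, T (S x) = x)
    {y : X} (hy : IsUniformlyRecurrentPt (fun (n : ℕ) (x : X) => T^[n] x) y) :
    IsUniformlyRecurrentPt (fun (n : ℕ) (x : X) => S^[n] x) y := by
  -- the two `ℕ`-actions
  have hTc : ∀ n : ℕ, Continuous fun x : X => T^[n] x := fun n => hT.iterate n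
  have hSc : ∀ n : ℕ, Continuous fun x : X => S^[n] x := fun n => hS.iterate n
  have hTa : ∀ (m n : ℕ) (x : X), T^[m + n] x = T^[m] (T^[n] x) := fun m n x =>
    Function.iterate_add_apply T m n x
  have hSa : ∀ (m n : ℕ) (x : X), S^[m + n] x = S^[m] (S^[n] x) := fun m n x =>
    Function.iterate_add_apply S m n x
  have hTj : Continuous fun p : ℕ × X => T^[p.1] p.2 := prTS_continuous_uncurry_nat hTc
  -- the `T`-orbit closure of `y`
  set M : Set X := closure (range fun n : ℕ => T^[n] y) with hM
  have hyM : y ∈ M := subset_closure ⟨0, rfl⟩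
  have hMc : IsCompact M := isClosed_closure.isCompact
  have hMT : ∀ n : ℕ, MapsTo (fun x : X => T^[n] x) M M := fun n =>
    mapsTo_closure_orbit hTc hTa n y
  -- `M ⊆ T '' M` (minimality of `M`, Furstenberg 1.17)
  have hTM : M ⊆ T '' M := by
    have h1 : IsClosed (T '' M) := (hMc.image hT).isClosed
    have h2 : ∀ n : ℕ, MapsTo (fun x : X => T^[n] x) (T '' M) (T '' M) := by
      rintro n _ ⟨m, hm, rfl⟩
      refine ⟨T^[n] m, hMT n hm, ?_⟩
      show T (T^[n] m) = T^[n] (T m)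
      rw [← Function.iterate_succ_apply' T n m, Function.iterate_succ_apply]
    have h3 : T y ∈ T '' M := mem_image_of_mem T hyM
    have h4 : T y ∈ M := subset_closure ⟨1, rfl⟩
    exact closure_orbit_subset_of_isUniformlyRecurrentPt hTj hTa hy h1 h2 h3 h4
  -- hence `M` is `S`-invariant
  have hSM : MapsTo S M M := by
    intro m hm
    obtain ⟨m', hm', rfl⟩ := hTM hm
    rw [hST]
    exact hm'
  have hSnM : ∀ n : ℕ, MapsTo (fun x : X => S^[n] x) M M := fun n => hSM.iterate n
  -- KEY: `y` lies in the `S`-orbit closure of every point of `M` (via the `S`-ω-limit set)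
  have hkey : ∀ z ∈ M, y ∈ closure (range fun n : ℕ => S^[n] z) := by
    intro z hz
    set t : ℕ → Set X := fun N => closure ((fun n : ℕ => S^[n] z) '' Ici N) with ht
    have htanti : ∀ i, t (i + 1) ⊆ t i := fun i =>
      closure_mono (image_mono (Ici_subset_Ici.2 (Nat.le_succ i)))
    have htne : ∀ i, (t i).Nonempty := fun i =>
      ⟨S^[i] z, subset_closure ⟨i, mem_Ici.2 le_rfl, rfl⟩⟩
    have ht0 : IsCompact (t 0) := isClosed_closure.isCompact
    have htcl : ∀ i, IsClosed (t i) := fun i => isClosed_closure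
    obtain ⟨a, ha⟩ :=
      IsCompact.nonempty_iInter_of_sequence_nonempty_isCompact_isClosed t htanti htne ht0 htcl
    -- the ω-limit set `⋂ i, t i` is closed and `T`-invariant
    have hAcl : IsClosed (⋂ i, t i) := isClosed_iInter htcl
    have hAT : MapsTo T (⋂ i, t i) (⋂ i, t i) := by
      intro w hw
      rw [mem_iInter] at hw ⊢
      intro N
      have hsub : T '' ((fun n : ℕ => S^[n] z) '' Ici (N + 1)) ⊆ (fun n : ℕ => S^[n] z) '' Ici N := by
        rintro _ ⟨_, ⟨n, hn, rfl⟩, rfl⟩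
        rw [mem_Ici] at hn
        obtain ⟨m, rfl⟩ : ∃ m, n = m + 1 := ⟨n - 1, by omega⟩
        refine ⟨m, mem_Ici.2 (by omega), ?_⟩
        show S^[m] z = T (S^[m + 1] z)
        rw [Function.iterate_succ_apply', hTS]
      exact closure_mono hsub (image_closure_subset_closure_image hT ⟨w, hw (N + 1), rfl⟩)
    have hATn : ∀ n : ℕ, MapsTo (fun x : X => T^[n] x) (⋂ i, t i) (⋂ i, t i) := fun n =>
      hAT.iterate n
    -- it lies inside `M`, hence (minimality) contains `M`, hence `y`
    have ht0M : t 0 ⊆ M := by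
      refine closure_minimal ?_ isClosed_closure
      rintro _ ⟨n, -, rfl⟩
      exact hSnM n hz
    have haM : a ∈ M := ht0M (mem_iInter.1 ha 0)
    have hMA : M ⊆ ⋂ i, t i :=
      closure_orbit_subset_of_isUniformlyRecurrentPt hTj hTa hy hAcl hATn ha haM
    exact closure_mono (image_subset_range _ _) (mem_iInter.1 (hMA hyM) 0)
  -- Birkhoff (Furstenberg 1.15) on the compact `S`-invariant set `M`
  exact isUniformlyRecurrentPt_of_mem_closure_orbit hSc hSa hMc hSnM hyM hkey

end Discrete

/-! ## The flow statement -/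

/-- **H2 · ONE-SIDED UNIFORM RECURRENCE IS TWO-SIDED.**  Let `ℝ` act on a compact Hausdorff space by
continuous maps with the action law and `ϕ 0 = id` (so every `ϕ t` is a homeomorphism).  If `y` is
uniformly recurrent for the BACKWARD unit-step action `n ↦ ϕ (−n)` (`n : ℕ`), then `y` is uniformly
recurrent for the whole flow: its return times to every neighbourhood are relatively dense in `ℝ`.
Proof (Gottschalk–Hedlund): with `T = ϕ (−1)` and `S = ϕ 1 = T⁻¹`, `ϕ (−n) = T^[n]` and
`ϕ n = S^[n]`; by `prTS_isUniformlyRecurrentPt_iterate_symm` the point `y` is also uniformly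
recurrent for the forward steps; integer return times with bounded gaps in both directions give a
real return time in every window of length `N₁ + N₂ + 1` (`isSyndetic_iff_exists_window`).
[cite: Furstenberg1981, Ch. 1 §4, Thm. 1.17] -/
theorem stub_prTwoSidedRecurrence {X : Type*} [TopologicalSpace X] [CompactSpace X] [T2Space X]
    {ϕ : ℝ → X → X} (hcont : ∀ t, Continuous (ϕ t))
    (hadd : ∀ s t x, ϕ (s + t) x = ϕ s (ϕ t x)) (h0 : ∀ x, ϕ 0 x = x) {y : X}
    (hy : IsUniformlyRecurrentPt (fun (n : ℕ) (x : X) => ϕ (-(n : ℝ)) x) y) :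
    IsUniformlyRecurrentPt ϕ y := by
  -- `T = ϕ (-1)` and `S = ϕ 1` are mutually inverse; integer times are iterates
  have hST : ∀ x, ϕ 1 (ϕ (-1) x) = x := fun x => by rw [← hadd, add_neg_cancel, h0]
  have hTS : ∀ x, ϕ (-1) (ϕ 1 x) = x := fun x => by rw [← hadd, neg_add_cancel, h0]
  have hψ : ∀ (n : ℕ) (x : X), ϕ (-(n : ℝ)) x = (ϕ (-1))^[n] x := by
    intro n
    induction n with
    | zero => intro x; rw [Nat.cast_zero, neg_zero, h0]; rfl
    | succ n ih =>
        intro x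
        rw [Function.iterate_succ_apply', ← ih, ← hadd]
        congr 1
        push_cast
        ring
  have hχ : ∀ (n : ℕ) (x : X), ϕ (n : ℝ) x = (ϕ 1)^[n] x := by
    intro n
    induction n with
    | zero => intro x; rw [Nat.cast_zero, h0]; rfl
    | succ n ih =>
        intro x
        rw [Function.iterate_succ_apply', ← ih, ← hadd]
        congr 1
        push_cast
        ring
  have hy' : IsUniformlyRecurrentPt (fun (n : ℕ) (x : X) => (ϕ (-1))^[n] x) y := by
    have : (fun (n : ℕ) (x : X) => ϕ (-(n : ℝ)) x) = fun n x => (ϕ (-1))^[n] x :=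
      funext fun n => funext fun x => hψ n x
    rw [this] at hy
    exact hy
  have hfwd : IsUniformlyRecurrentPt (fun (n : ℕ) (x : X) => (ϕ 1)^[n] x) y :=
    prTS_isUniformlyRecurrentPt_iterate_symm (hcont (-1)) (hcont 1) hST hTS hy'
  -- assemble the real window
  intro U hU
  obtain ⟨N₁, hN₁⟩ := prTS_exists_bound_of_isSyndetic (hy U hU)
  obtain ⟨N₂, hN₂⟩ := prTS_exists_bound_of_isSyndetic (hfwd U hU)
  rw [isSyndetic_iff_exists_window]
  refine ⟨(N₁ : ℝ) + N₂ + 1, by positivity, fun a => ?_⟩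
  rcases le_or_gt 0 a with ha | ha
  · -- forward return after `⌈a⌉₊`
    obtain ⟨k, hk, hgk⟩ := hN₂ ⌈a⌉₊
    have hk' : (k : ℝ) ≤ N₂ := by exact_mod_cast hk
    have hc1 := Nat.le_ceil a
    have hc2 := Nat.ceil_lt_add_one ha
    refine ⟨((⌈a⌉₊ + k : ℕ) : ℝ), ⟨?_, ?_⟩, ?_⟩
    · push_cast
      linarith [(k.cast_nonneg : (0 : ℝ) ≤ k)]
    · push_cast
      linarith
    · show ϕ (((⌈a⌉₊ + k : ℕ) : ℝ)) y ∈ U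
      rw [hχ]
      exact hgk
  rcases le_or_gt 0 (a + ((N₁ : ℝ) + N₂ + 1)) with ha' | ha'
  · -- `0` is a return time
    refine ⟨0, ⟨ha.le, ha'⟩, ?_⟩
    show ϕ 0 y ∈ U
    rw [h0]
    exact mem_of_mem_nhds hU
  · -- backward return after `⌈-(a + L)⌉₊`
    have hx0 : 0 ≤ -(a + ((N₁ : ℝ) + N₂ + 1)) := by linarith
    obtain ⟨k, hk, hgk⟩ := hN₁ ⌈-(a + ((N₁ : ℝ) + N₂ + 1))⌉₊
    have hk' : (k : ℝ) ≤ N₁ := by exact_mod_cast hk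
    have hc1 := Nat.le_ceil (-(a + ((N₁ : ℝ) + N₂ + 1)))
    have hc2 := Nat.ceil_lt_add_one hx0
    refine ⟨-((⌈-(a + ((N₁ : ℝ) + N₂ + 1))⌉₊ + k : ℕ) : ℝ), ⟨?_, ?_⟩, ?_⟩
    · push_cast
      linarith
    · push_cast
      linarith [(k.cast_nonneg : (0 : ℝ) ≤ k)]
    · show ϕ (-((⌈-(a + ((N₁ : ℝ) + N₂ + 1))⌉₊ + k : ℕ) : ℝ)) y ∈ U
      exact hgk

end Summit.NavierStokesRegularity.NavierStokesRegularity.Theorems
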